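import Summits.HubbardSuperconductivity.HubbardSuperconductivity.Theorems.AnisotropyChordTransferFlipGraph
import Summits.HubbardSuperconductivity.HubbardSuperconductivity.Theorems.AnisotropyChordTransferRotatedPackage

/-!
# Route `AnisotropyChord` / H0 rotor rung, route (1): **THEOREM L1 ON GENERAL GRAPHS** — the theory seat's `SectorOneBelowHigherGraph`
# (PartF.lean, VERBATIM), and the strict THEOREM Z on graphs

For the spin-½ XXZ ferromagnet `H(Δ) = xxzHamiltonian 1 G (−1) Δ` on a finite CONNECTED graph with an EVEN number of vertices and `|Δ| < 1`
(bipartiteness NOT assumed), with `E(M) = lowestEnergyInSector 1 H(Δ) M` and all sectors below non-empty: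

* **`xxz_level_structure_graph`**: `E(0) < E(M)` for `M ≠ 0`; `E(1) ≤ E(M)` for `M ≠ 0`; `E(1) < E(M)` for `|M| ≥ 2`;
* **`sectorOneBelowHigherGraph_holds : SectorOneBelowHigherGraph`** (theory seat g12, THEOREM L1 on general graphs — VARIANT of Mattis 1979,
  not located in print for non-bipartite graphs).

Assembly: the two-block core (`…TransferTwoBlock`) fed with the general-graph frame (`exists_frame_xyzBondHamiltonianOn`), the flip-symmetric
sector-`0` ground vector and the flip operator `⨂σˣ ↦ ⨂(−σᶻ)` (`…TransferFlipGraph`, `frame_conj_flipXOp`).  Prover seat `hubbard-h0-rotor-p1` g14.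
-/

set_option linter.dupNamespace false
set_option autoImplicit false

noncomputable section

open Finset Matrix
open scoped ComplexOrder
open Literature.MathematicalPhysics.QuantumLattice Literature.MathematicalPhysics.QuantumLattice.SpinOperators

namespace Summit.HubbardSuperconductivity.HubbardSuperconductivity.Theorems.AnisotropyChord.Transfer

section GraphL1

variable {Λ : Type*} [Fintype Λ] [DecidableEq Λ] (G : SimpleGraph Λ) [DecidableRel G.Adj]

/-- **THE LEVEL STRUCTURE ON A GRAPH (`|Δ| < 1`, connected, `|V|` even).**  For every non-empty sector `M ≠ 0`:
`E(0) < E(M)`, `E(1) ≤ E(M)`, and `E(1) < E(M)` when `|M| ≥ 2`.  THEOREM Z⁺ (strict) + THEOREM L1 of the theory seat on general graphs. [folklore] -/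
theorem xxz_level_structure_graph (hG : G.Connected) (hV : Even (Fintype.card Λ)) {Δ : ℝ} (hΔ : |Δ| < 1) (M : ℝ)
    (hM : spinZSector (Λ := Λ) 1 M ≠ ⊥) (hM0 : M ≠ 0) :
    lowestEnergyInSector 1 (xxzHamiltonian 1 G (-1) Δ) 0 < lowestEnergyInSector 1 (xxzHamiltonian 1 G (-1) Δ) M ∧
    lowestEnergyInSector 1 (xxzHamiltonian 1 G (-1) Δ) 1 ≤ lowestEnergyInSector 1 (xxzHamiltonian 1 G (-1) Δ) M ∧
    (2 ≤ |M| → lowestEnergyInSector 1 (xxzHamiltonian 1 G (-1) Δ) 1 < lowestEnergyInSector 1 (xxzHamiltonian 1 G (-1) Δ) M) := by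
  obtain ⟨m, hm'⟩ := hV
  have hm : Fintype.card Λ = 2 * m := by rw [hm']; ring
  have hne : Nonempty Λ := hG.nonempty
  obtain ⟨x₀⟩ := hne
  set H : Op Λ 2 := xxzHamiltonian 1 G (-1) Δ with hHdef
  have hH : H.IsHermitian := xxzHamiltonian_isHermitian 1 G (-1) Δ
  -- `E(0)` is the ground energy and bounds the quadratic form
  obtain ⟨u, hu0, hE, hHu, hSzu⟩ := exists_groundVector_sectorZero_graph G hG hm hΔ
  have humem : u ∈ spinZSector (Λ := Λ) 1 (0 : ℝ) := by
    rw [spinZSector, Module.End.mem_eigenspace_iff, Matrix.toLin'_apply, hSzu, Complex.ofReal_zero, zero_smul]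
  have hE0le : lowestEnergyInSector 1 H 0 ≤ H.minEnergyOn ⊤ := by
    have h := minEnergyOn_mul_le_re_rayleigh hH (spinZSector (Λ := Λ) 1 (0 : ℝ)) humem
    rw [hHu, dotProduct_smul, smul_eq_mul, Complex.re_ofReal_mul] at h
    exact le_of_mul_le_mul_right h (EigenvalueContinuation.re_star_dotProduct_self_pos hu0)
  -- the flip-symmetric sector-0 eigenvector and the frame
  obtain ⟨ψ₀, hψ₀0, hψ₀nn, hψ₀K, hHψ₀, hFψ₀⟩ := exists_flipSymmetric_sectorZero_ground G hm Δ
  have hE0ge : H.minEnergyOn ⊤ ≤ lowestEnergyInSector 1 H 0 := by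
    have h := hE ψ₀
    rw [hHψ₀, dotProduct_smul, smul_eq_mul, Complex.re_ofReal_mul] at h
    exact le_of_mul_le_mul_right h (EigenvalueContinuation.re_star_dotProduct_self_pos hψ₀0)
  have hE0eq : lowestEnergyInSector 1 H 0 = H.minEnergyOn ⊤ := le_antisymm hE0le hE0ge
  obtain ⟨U, hU, hU', hUH, hUx, hUy, hUz⟩ := exists_frame_xyzBondHamiltonianOn G 1 1 1 Δ
  rw [← xxzHamiltonian_eq_xyzBondHamiltonianOn] at hUH
  set Ht := xyzBondHamiltonianOn G 1 1 Δ 1 with hHtdef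
  have hΔ1 : -Δ ≤ 1 := by have := (abs_lt.1 hΔ).1; linarith
  have hΔ2 : Δ ≤ 1 := (abs_lt.1 hΔ).2.le
  obtain ⟨hreal, hsymm, hoff⟩ := xyzBondHamiltonianOn_entries G 1 1 Δ 1 hΔ1 hΔ2
  have hHt : Ht.IsHermitian := xyzBondHamiltonianOn_isHermitian G 1 1 Δ 1
  have hpar : ∀ σ τ : TensorIndex Λ 2, (∑ z, (σ z : ℕ)) % 2 ≠ (∑ z, (τ z : ℕ)) % 2 → Ht σ τ = 0 :=
    fun σ τ h => xyzBondHamiltonianOn_one_apply_of_parity_ne G 1 Δ 1 h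
  have hflip : ∀ (x y : Λ) (σ : TensorIndex Λ 2), G.Adj x y → Ht σ (flipAt x (flipAt y σ)) ≠ 0 := by
    intro x y σ hxy
    rw [hHtdef, xyzBondHamiltonianOn_one_apply_doubleFlip G 1 Δ 1 hxy σ, neg_ne_zero, Complex.ofReal_ne_zero]
    have h1 := (abs_lt.1 hΔ).1
    have h2 := (abs_lt.1 hΔ).2
    split_ifs <;> · intro h; linarith
  have hSz : U * (totalSpin 1 2 : Op Λ 2) * Uᴴ = -(totalSpin 1 1 : Op Λ 2) := by
    rw [totalSpin, totalSpin, Finset.mul_sum, Finset.sum_mul, ← Finset.sum_neg_distrib]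
    exact Finset.sum_congr rfl fun x _ => hUz x
  have hSy : U * (totalSpin 1 1 : Op Λ 2) * Uᴴ = (totalSpin 1 0 : Op Λ 2) := by
    rw [totalSpin, totalSpin, Finset.mul_sum, Finset.sum_mul]
    exact Finset.sum_congr rfl fun x _ => hUy x
  have hFlip := frame_conj_flipXOp hU hU' hUx
  have hcomm := (HardCoreBoson.commute_xxzHamiltonian_totalSpin_two 1 G (-1) Δ).eq
  have hHY : Ht * (totalSpin 1 1 : Op Λ 2) = (totalSpin 1 1 : Op Λ 2) * Ht := by
    have h2 : (totalSpin 1 1 : Op Λ 2) = -(U * (totalSpin 1 2 : Op Λ 2) * Uᴴ) := by rw [hSz, neg_neg]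
    rw [← hUH, h2, mul_neg, neg_mul, conj_mul_conj hU' _ _, conj_mul_conj hU' _ _, hcomm]
  have hYh : (totalSpin 1 1 : Op Λ 2)ᴴ = totalSpin 1 1 := (totalSpin_isHermitian 1 1).eq
  have hYpar : ∀ σ τ : TensorIndex Λ 2, (∑ z, (σ z : ℕ)) % 2 = (∑ z, (τ z : ℕ)) % 2 → (totalSpin 1 1 : Op Λ 2) σ τ = 0 :=
    fun σ τ h => totalSpin_one_one_apply_of_parity_eq h
  have hX : ∀ (v : TensorIndex Λ 2 → ℂ) (τ : TensorIndex Λ 2), ((totalSpin 1 0 : Op Λ 2) *ᵥ v) τ = (∑ x, v (flipAt x τ)) / 2 :=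
    totalSpin_one_zero_mulVec
  -- rotated lower bound with `E(0)`
  have hEt : ∀ v : TensorIndex Λ 2 → ℂ, lowestEnergyInSector 1 H 0 * (star v ⬝ᵥ v).re ≤ (star v ⬝ᵥ Ht *ᵥ v).re := by
    intro v
    rw [hE0eq, ← hUH, star_dotProduct_conj_mulVec, ← star_dotProduct_conjTranspose_mulVec hU v]
    exact hE _
  -- the rotated Perron data `P = U ψ₀`
  have hYU : ∀ w : TensorIndex Λ 2 → ℂ, (totalSpin 1 1 : Op Λ 2) *ᵥ (U *ᵥ w) = -(U *ᵥ ((totalSpin 1 2 : Op Λ 2) *ᵥ w)) := by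
    intro w
    have h2 : (totalSpin 1 1 : Op Λ 2) = -(U * (totalSpin 1 2 : Op Λ 2) * Uᴴ) := by rw [hSz, neg_neg]
    rw [h2, Matrix.neg_mulVec, conj_mulVec_mulVec hU']
  have hP0 : U *ᵥ ψ₀ ≠ 0 := mulVec_ne_zero_of_left_inverse hU' hψ₀0
  have hPiU : productOp (fun _ : Λ => -spinHalfPauli 2) * U = U * productOp (fun _ : Λ => spinHalfPauli 0) := by
    rw [← hFlip, Matrix.mul_assoc, hU', Matrix.mul_one]
  have hPsupp : ∀ σ : TensorIndex Λ 2, (∑ z, (σ z : ℕ)) % 2 ≠ 0 → (U *ᵥ ψ₀) σ = 0 := by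
    intro σ hσ
    have h1 : productOp (fun _ : Λ => -spinHalfPauli 2) *ᵥ (U *ᵥ ψ₀) = U *ᵥ ψ₀ := by
      rw [Matrix.mulVec_mulVec, hPiU, ← Matrix.mulVec_mulVec, hFψ₀]
    have h3 := congrFun h1 σ
    rw [parityOp_mulVec hm] at h3
    have hσ1 : (∑ z, (σ z : ℕ)) % 2 = 1 := by have := Nat.mod_lt (∑ z, (σ z : ℕ)) two_pos; omega
    rw [neg_one_pow_eq_pow_mod_two (R := ℂ), hσ1, pow_one, neg_one_mul] at h3
    have : (2 : ℂ) * (U *ᵥ ψ₀) σ = 0 := by linear_combination -h3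
    exact (mul_eq_zero.1 this).resolve_left two_ne_zero
  have hHP : Ht *ᵥ (U *ᵥ ψ₀) = ((lowestEnergyInSector 1 H 0 : ℝ) : ℂ) • (U *ᵥ ψ₀) := by
    rw [← hUH, conj_mulVec_mulVec hU', hHψ₀, Matrix.mulVec_smul]
  have hSzψ₀ : (totalSpin 1 2 : Op Λ 2) *ᵥ ψ₀ = 0 := by
    rw [LiebMattis.totalSpin_two_mulVec_of_mem 1 hψ₀K, Complex.ofReal_zero, zero_smul]
  have hYP : (totalSpin 1 1 : Op Λ 2) *ᵥ (U *ᵥ ψ₀) = 0 := by rw [hYU, hSzψ₀, Matrix.mulVec_zero, neg_zero]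
  have hYYX : (totalSpin 1 1 : Op Λ 2) *ᵥ ((totalSpin 1 1 : Op Λ 2) *ᵥ ((totalSpin 1 0 : Op Λ 2) *ᵥ (U *ᵥ ψ₀))) =
      (totalSpin 1 0 : Op Λ 2) *ᵥ (U *ᵥ ψ₀) := by
    rw [← hSy, conj_mulVec_mulVec hU', hYU, Matrix.mulVec_neg, hYU, neg_neg, sz_sz_sy_mulVec_of_mem_zero hψ₀K]
  -- the sector-`M` eigenvector and its rotated parity components
  obtain ⟨ψ, hψK, hψ1, hHψ, hdisj⟩ := exists_sector_eigenvector_flip_disjoint G hm Δ hM hM0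
  have hψ0 : ψ ≠ 0 := by intro h; rw [h, dotProduct_zero] at hψ1; exact zero_ne_one hψ1
  have hHψt : Ht *ᵥ (U *ᵥ ψ) = ((lowestEnergyInSector 1 H M : ℝ) : ℂ) • (U *ᵥ ψ) := by
    rw [← hUH, conj_mulVec_mulVec hU', hHψ, Matrix.mulVec_smul]
  have hYψ : (totalSpin 1 1 : Op Λ 2) *ᵥ (U *ᵥ ψ) = (-(M : ℂ)) • (U *ᵥ ψ) := by
    rw [hYU, LiebMattis.totalSpin_two_mulVec_of_mem 1 hψK, Matrix.mulVec_smul, neg_smul]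
  have hμ : (-(M : ℂ)) ≠ 0 := neg_ne_zero.2 (by exact_mod_cast hM0)
  have hcomp : ∀ r : ℕ, r < 2 → (fun σ => if (∑ z, (σ z : ℕ)) % 2 = r then (U *ᵥ ψ) σ else 0) ≠ 0 := by
    intro r hr
    set Fψ : TensorIndex Λ 2 → ℂ := productOp (fun _ : Λ => spinHalfPauli 0) *ᵥ ψ with hFψ
    have h1 : productOp (fun _ : Λ => -spinHalfPauli 2) *ᵥ (U *ᵥ ψ) = U *ᵥ Fψ := by
      rw [Matrix.mulVec_mulVec, hPiU, ← Matrix.mulVec_mulVec]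
    set s : ℂ := (-1) ^ r with hs
    have hc : (fun σ => if (∑ z, (σ z : ℕ)) % 2 = r then (U *ᵥ ψ) σ else 0) = (2 : ℂ)⁻¹ • (U *ᵥ ψ + s • (U *ᵥ Fψ)) := by
      funext σ
      have h3 := congrFun h1 σ
      rw [parityOp_mulVec hm, neg_one_pow_eq_pow_mod_two (R := ℂ)] at h3
      rw [Pi.smul_apply, Pi.add_apply, Pi.smul_apply, smul_eq_mul, smul_eq_mul, ← h3, hs]
      have h01 : (∑ z, (σ z : ℕ)) % 2 = 0 ∨ (∑ z, (σ z : ℕ)) % 2 = 1 := Nat.mod_two_eq_zero_or_one _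
      interval_cases r <;> rcases h01 with h | h <;> simp [h] <;> ring
    obtain ⟨σ₀, hσ₀⟩ := Function.ne_iff.1 hψ0
    have hF0 : Fψ σ₀ = 0 := by
      rw [hFψ, flipXOp_mulVec]
      exact (mul_eq_zero.1 (hdisj σ₀)).resolve_left hσ₀
    have hne' : ψ + s • Fψ ≠ 0 := by
      intro h
      have h4 := congrFun h σ₀
      rw [Pi.add_apply, Pi.smul_apply, smul_eq_mul, hF0, mul_zero, add_zero, Pi.zero_apply] at h4
      exact hσ₀ h4
    rw [hc]
    refine smul_ne_zero (inv_ne_zero two_ne_zero) ?_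
    rw [← Matrix.mulVec_smul, ← Matrix.mulVec_add]
    exact mulVec_ne_zero_of_left_inverse hU' hne'
  obtain ⟨h0lt, hole, holt⟩ := energy_bounds_of_twoBlock G hG x₀ _ _ _ hHt hreal hsymm hoff hpar hflip hHY hYh hYpar hX hEt hP0
    hPsupp hHP hYP hYYX hHψt hYψ hμ (hcomp 0 two_pos) (hcomp 1 one_lt_two)
  -- `E(1) ≤ E_o`
  obtain ⟨p, hp0, hHp, hYp⟩ := exists_oddGround_Y_eq G hG x₀ _ _ _ hHt hreal hsymm hoff hpar hflip hHY hYh hYpar hX hEt hP0 hPsupp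
    hHP hYYX
  set Eo : ℝ := Ht.minEnergyOn (paritySubmodule (Λ := Λ) 1) with hEo
  have hHU : H = Uᴴ * Ht * U := by
    rw [← hUH]
    calc H = (Uᴴ * U) * H * (Uᴴ * U) := by rw [hU', Matrix.one_mul, Matrix.mul_one]
      _ = Uᴴ * (U * H * Uᴴ) * U := by simp only [Matrix.mul_assoc]
  have hSzU : (totalSpin 1 2 : Op Λ 2) = -(Uᴴ * (totalSpin 1 1 : Op Λ 2) * U) := by
    calc (totalSpin 1 2 : Op Λ 2) = (Uᴴ * U) * totalSpin 1 2 * (Uᴴ * U) := by rw [hU', Matrix.one_mul, Matrix.mul_one]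
      _ = Uᴴ * (U * totalSpin 1 2 * Uᴴ) * U := by simp only [Matrix.mul_assoc]
      _ = -(Uᴴ * totalSpin 1 1 * U) := by rw [hSz, Matrix.mul_neg, Matrix.neg_mul, Matrix.mul_assoc]
  have hu0' : Uᴴ *ᵥ p ≠ 0 := mulVec_ne_zero_of_left_inverse (U := Uᴴ) (V := U) hU hp0
  have hHu' : H *ᵥ (Uᴴ *ᵥ p) = (Eo : ℂ) • (Uᴴ *ᵥ p) := by
    rw [hHU, Matrix.mulVec_mulVec, Matrix.mul_assoc, Matrix.mul_assoc, hU, Matrix.mul_one, ← Matrix.mulVec_mulVec, hHp,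
      Matrix.mulVec_smul]
  have hsec : ∀ s : ℝ, (totalSpin 1 2 : Op Λ 2) *ᵥ (Uᴴ *ᵥ p) = (s : ℂ) • (Uᴴ *ᵥ p) → lowestEnergyInSector 1 H s ≤ Eo := by
    intro s hs
    have hmem : Uᴴ *ᵥ p ∈ spinZSector (Λ := Λ) 1 s := by
      rw [spinZSector, Module.End.mem_eigenspace_iff, Matrix.toLin'_apply, hs]
    have h := minEnergyOn_mul_le_re_rayleigh hH (spinZSector (Λ := Λ) 1 s) hmem
    rw [hHu', dotProduct_smul, smul_eq_mul, Complex.re_ofReal_mul] at h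
    exact le_of_mul_le_mul_right h (EigenvalueContinuation.re_star_dotProduct_self_pos hu0')
  have hSzu' : (totalSpin 1 2 : Op Λ 2) *ᵥ (Uᴴ *ᵥ p) = -(Uᴴ *ᵥ ((totalSpin 1 1 : Op Λ 2) *ᵥ p)) := by
    rw [hSzU, Matrix.neg_mulVec, Matrix.mulVec_mulVec, Matrix.mul_assoc, Matrix.mul_assoc, hU, Matrix.mul_one, ← Matrix.mulVec_mulVec]
  have h1le : lowestEnergyInSector 1 H 1 ≤ Eo := by
    rcases hYp with hYp | hYp
    · rw [← lowestEnergyInSector_neg_eq G Δ 1]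
      refine hsec (-1) ?_
      rw [hSzu', hYp]; push_cast; rw [neg_one_smul]
    · refine hsec 1 ?_
      rw [hSzu', hYp, Matrix.mulVec_neg, neg_neg]; push_cast; rw [one_smul]
  refine ⟨h0lt, h1le.trans hole, fun h2 => lt_of_le_of_lt h1le (holt ?_)⟩
  intro hsq
  have h3 : ((M ^ 2 : ℝ) : ℂ) = 1 := by rw [← hsq]; push_cast; ring
  have h4 : M ^ 2 = 1 := by exact_mod_cast h3
  have h5 : |M| ^ 2 = 1 := by rw [sq_abs]; exact h4
  nlinarith [abs_nonneg M]

end GraphL1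

/-! ## The theory seat's general-graph THEOREM L1 -/

/-- **THEOREM L1 on general graphs** (VERBATIM port of the theory seat's `SectorOneBelowHigherGraph`, PartF.lean, g12): the sectors `M = ±1` lie
strictly below every sector `|M| ≥ 2` — uniform couplings, any finite connected graph with an even number of vertices, `|Δ| < 1`.
[conjecture: theory seat hubbard-h0-rotor-theory-1, cycle 12, THEOREM-L1.md — THEOREM L1 on general graphs, PROVED on paper; Lean proof below] -/
def SectorOneBelowHigherGraph : Prop :=
  ∀ (V : Type) [Fintype V] [DecidableEq V] (G : SimpleGraph V) [DecidableRel G.Adj] (Δ M : ℝ),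
    |Δ| < 1 → G.Connected → Even (Fintype.card V) →
    spinZSector (Λ := V) 1 M ≠ ⊥ → 2 ≤ |M| →
      lowestEnergyInSector 1 (xxzHamiltonian 1 G (-1) Δ) 1
        < lowestEnergyInSector 1 (xxzHamiltonian 1 G (-1) Δ) M

/-- **THEOREM L1 HOLDS on every finite connected graph with an even number of vertices, `|Δ| < 1`.** [folklore] -/
theorem sectorOneBelowHigherGraph_holds : SectorOneBelowHigherGraph := by
  intro V _ _ G _ Δ M hΔ hG hV hM h2
  have hM0 : M ≠ 0 := by intro h; rw [h, abs_zero] at h2; linarith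
  exact ((xxz_level_structure_graph G hG hV hΔ M hM hM0).2.2) h2

/-- **THEOREM Z, strict form on general graphs**: `E(0) < E(M)` for every non-empty sector `M ≠ 0` (connected, even number of vertices,
`|Δ| < 1`). [folklore] -/
theorem lowestEnergyInSector_zero_lt_graph {V : Type*} [Fintype V] [DecidableEq V] (G : SimpleGraph V) [DecidableRel G.Adj]
    (hG : G.Connected) (hV : Even (Fintype.card V)) {Δ : ℝ} (hΔ : |Δ| < 1) (M : ℝ) (hM : spinZSector (Λ := V) 1 M ≠ ⊥) (hM0 : M ≠ 0) :
    lowestEnergyInSector 1 (xxzHamiltonian 1 G (-1) Δ) 0 < lowestEnergyInSector 1 (xxzHamiltonian 1 G (-1) Δ) M :=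
  (xxz_level_structure_graph G hG hV hΔ M hM hM0).1

end Summit.HubbardSuperconductivity.HubbardSuperconductivity.Theorems.AnisotropyChord.Transfer
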